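import Summits.KontsevichZagierPeriods.KontsevichZagierPeriods.Theorems.RootDecompRelativeModAbsoluteCylLogSplitP26

/-! # `RootDecompRelativeModAbsoluteCylLogSplitP27` — part 2/27 of the mechanical ≤400-line split of `RungClosure.lean` (sha256 f909f334226f0fb5…)
Source: decomp-kz lens-3 g12 `RungClosure.lean` v9 (HOME/decomp-kz-lens-3/g12/, sha256 f909f334…; critic g4-52/g4-57/g5 CLEARED, «lander: split v9 --supports 30572»): BLOCK I (57 g11 monolith decls missing from P01–P25), BLOCK II/III (WildCertAssembly parts 1–6, 8–10: `Leaf.cellLocalWildCert`, `Leaf.cylKernelZeroLog_of_trees`), Parts 12–13 (`Leaf.regKernelPairDegOne_iff_circlePos_of_trees`), BLOCK G13 (Möbius engine, test §C decided).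
Split by census-1 g9 `gen/splitlean.py`: scopes re-opened with their `open`/`variable`/`set_option` context; mathematics and declaration order unchanged. -/

noncomputable section
open Set MeasureTheory Filter Topology
open scoped BigOperators
open Literature.NumberTheory.Transcendental Literature.ModelTheory.ExponentialFields
namespace Summit.KontsevichZagierPeriods.RootDecompRelativeModAbsolute.Rung30571
namespace RegularisedLogLayer
namespace CylLog
variable {b : ℕ}

/-- For `0 < W ≤ 1`: `|d (W−1)^{j+1}| ≤ ‖d log W‖`, so the power bounds of a reversed cell follow from the log bound. -/
theorem integrableOn_mul_pow_of_log {b : ℕ} {G : Set (Fin b → ℝ)} (hG : IsSemialgebraic ℚ G)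
    {d W : (Fin b → ℝ) → ℝ} (hd : IsSemialgebraicFunOn ℚ G d) (hW : IsSemialgebraicFunOn ℚ G W)
    (hW0 : ∀ x ∈ G, 0 < W x) (hW1 : ∀ x ∈ G, W x ≤ 1)
    (hlog : IntegrableOn (fun x => d x * Real.log (W x)) G) (j : ℕ) :
    IntegrableOn (fun x => d x * (W x - 1) ^ (j + 1)) G := by
  have hGm : MeasurableSet G := hG.measurableSet_holds
  have hsa : IsSemialgebraicFunOn ℚ G (fun x => d x * (W x - 1) ^ (j + 1)) :=
    IsSemialgebraicFunOn.mul_holds hd (isSemialgebraicFunOn_pow' hG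
      ((IsSemialgebraicFunOn.sub_holds hW (isSemialgebraicFunOn_ratCast hG 1)).congr fun x _ => by simp) (j + 1))
  refine Integrable.mono' hlog.norm (KZ.aestronglyMeasurable_of_isSemialgebraicFunOn hsa hGm) ?_
  refine (ae_restrict_iff' hGm).mpr (Filter.Eventually.of_forall fun x hx => ?_)
  have h0 := hW0 x hx
  have h1 := hW1 x hx
  have habs : |W x - 1| ≤ 1 := by rw [abs_sub_comm, abs_of_nonneg (by linarith)]; linarith
  have hle : |W x - 1| ≤ |Real.log (W x)| := by
    rw [abs_sub_comm, abs_of_nonneg (by linarith), abs_of_nonpos (Real.log_nonpos h0.le h1)]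
    linarith [Real.log_le_sub_one_of_pos h0]
  rw [norm_mul, norm_mul, Real.norm_eq_abs, Real.norm_eq_abs, Real.norm_eq_abs, abs_pow]
  refine mul_le_mul_of_nonneg_left ?_ (abs_nonneg _)
  calc |W x - 1| ^ (j + 1) ≤ |W x - 1| := pow_le_of_le_one (abs_nonneg _) habs (Nat.succ_ne_zero j)
    _ ≤ |Real.log (W x)| := hle

/-- **THE TAME CLASS CLOSES (g11; PROVED from the tree theorem `BoundaryRigidity` BY NAME).**  A σ-oriented family of
honest regularised cells `P_i = [band_i, d_i (t−1)^{M_i}/t]` over an open `ℚ`-sa base `G` (`σ i`: band `[1, W_i]`,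
`W_i ≥ 1`; `¬σ i`: band `[W_i, 1]`, `0 < W_i ≤ 1`, `W_i` differentiable) with the LOG IDENTITY
`Σ_i (−1)^{M_i} d_i log W_i = 0` on `G` and the TAMENESS bounds `d_i log W_i ∈ L¹(G)` and (for `σ i`)
`d_i (W_i−1)^{j+1} ∈ L¹(G)` (`j < M_i`) satisfies `Σ_i ε_i [P_i] − [G, Σ_i d_i polyLog_{M_i}(W_i)] ∈ KZ.relations`. -/
theorem tameClose
    (hBR : Summit.KontsevichZagierPeriods.LiouvilleUnfolding.LogPrimitiveNL.Negative.BoundaryRigidity)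
    {b k : ℕ} {G : Set (Fin b → ℝ)} (hGo : IsOpen G) (hG : IsSemialgebraic ℚ G)
    (d W : Fin k → (Fin b → ℝ) → ℝ) (M : Fin k → ℕ)
    (hd : ∀ i, IsSemialgebraicFunOn ℚ G (d i)) (hW : ∀ i, IsSemialgebraicFunOn ℚ G (W i))
    (hWd : ∀ i, DifferentiableOn ℝ (W i) G)
    (σ : Fin k → Bool) (hσt : ∀ i, σ i = true → ∀ x ∈ G, 1 ≤ W i x)
    (hσf : ∀ i, σ i = false → ∀ x ∈ G, 0 < W i x ∧ W i x ≤ 1)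
    (hlog : ∀ i, IntegrableOn (fun x => d i x * Real.log (W i x)) G)
    (hpow : ∀ i, σ i = true → ∀ j, j < M i → IntegrableOn (fun x => d i x * (W i x - 1) ^ (j + 1)) G)
    (hsum : ∀ x ∈ G, ∑ i, (-1) ^ M i * d i x * Real.log (W i x) = 0)
    (P : Fin k → KZ.IntegralRep (b + 1))
    (hPd : ∀ i, (P i).domain =
      if σ i then KZlog.band G (fun _ => 1) (W i) else KZlog.band G (W i) (fun _ => 1))
    (hPi : ∀ i, EqOn (P i).integrand
      (fun z => d i (Fin.init z) * ((z (Fin.last b) - 1) ^ M i / z (Fin.last b))) (P i).domain)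
    (B : KZ.IntegralRep b) (hBd : B.domain = G)
    (hBi : EqOn B.integrand (fun x => ∑ i, d i x * polyLog (M i) (W i x)) G) :
    ∑ i, (if σ i then (1:ℤ) else -1) • KZ.of (P i) - KZ.of B ∈ KZ.relations := by
  classical
  -- signs and elementary facts
  let ε : Fin k → ℤ := fun i => if σ i then 1 else -1
  show ∑ i, ε i • KZ.of (P i) - KZ.of B ∈ KZ.relations
  have hGm : MeasurableSet G := hG.measurableSet_holds
  have h1sa : IsSemialgebraicFunOn ℚ G (fun _ => (1:ℝ)) :=
    (isSemialgebraicFunOn_ratCast hG 1).congr fun _ _ => by simp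
  have hW0 : ∀ i, ∀ x ∈ G, 0 < W i x := fun i x hx => by
    cases hσ : σ i
    · exact (hσf i hσ x hx).1
    · linarith [hσt i hσ x hx]
  have hWs : ∀ i, IsSemialgebraicFunOn ℚ G (fun x => W i x - 1) := fun i =>
    (IsSemialgebraicFunOn.sub_holds (hW i) (isSemialgebraicFunOn_ratCast hG 1)).congr fun x _ => by simp
  -- uniform power bounds (for `¬σ i` they follow from the log bound)
  have hpow' : ∀ i j, j < M i → IntegrableOn (fun x => d i x * (W i x - 1) ^ (j + 1)) G := by
    intro i j hj
    cases hσ : σ i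
    · exact integrableOn_mul_pow_of_log hG (hd i) (hW i) (fun x hx => (hσf i hσ x hx).1)
        (fun x hx => (hσf i hσ x hx).2) (hlog i) j
    · exact hpow i hσ j hj
  -- the band of index `i`
  let Dom : Fin k → Set (Fin (b + 1) → ℝ) := fun i =>
    if σ i then KZlog.band G (fun _ => 1) (W i) else KZlog.band G (W i) (fun _ => 1)
  -- (1) the cells of LOWER order `j < M_i` exist (tameness)
  have hPj : ∀ i j, j < M i → ∃ R : KZ.IntegralRep (b + 1), R.domain = Dom i ∧
      R.integrand = fun z => d i (Fin.init z) * ((z (Fin.last b) - 1) ^ j / z (Fin.last b)) := by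
    intro i j hj
    cases hσ : σ i
    · obtain ⟨R, hRd, hRi⟩ := exists_regRep_of_integrableOn_log' (m := j) hG (hd i) (hW i)
        (fun x hx => (hσf i hσ x hx).1) (fun x hx => (hσf i hσ x hx).2) (hlog i)
      exact ⟨R, by simp [Dom, hσ, hRd], hRi⟩
    · cases j with
      | zero =>
        obtain ⟨R, hRd, hRi⟩ := exists_regRep_of_integrableOn_pow (m := 0) hG (hd i) (hW i) (hσt i hσ)
          (hpow i hσ 0 hj)
        exact ⟨R, by simp [Dom, hσ, hRd], hRi⟩
      | succ j =>
        obtain ⟨R, hRd, hRi⟩ := exists_regRep_of_integrableOn_pow (m := j + 1) hG (hd i) (hW i) (hσt i hσ)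
          (hpow i hσ (j + 1) hj)
        exact ⟨R, by simp [Dom, hσ, hRd], hRi⟩
  let P' : Fin k → ℕ → KZ.IntegralRep (b + 1) := fun i j =>
    if h : j < M i then (hPj i j h).choose else P i
  have hP'd : ∀ i j, j ≤ M i → (P' i j).domain = Dom i := by
    intro i j hj
    by_cases h : j < M i
    · simp only [P', dif_pos h]
      exact (hPj i j h).choose_spec.1
    · have hjM : j = M i := le_antisymm hj (not_lt.mp h)
      simp only [P', dif_neg h]
      rw [hPd i]
  have hP'i : ∀ i j, j ≤ M i → EqOn (P' i j).integrand
      (fun z => d i (Fin.init z) * ((z (Fin.last b) - 1) ^ j / z (Fin.last b))) (P' i j).domain := by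
    intro i j hj
    by_cases h : j < M i
    · simp only [P', dif_pos h]
      rw [(hPj i j h).choose_spec.2]
      exact fun _ _ => rfl
    · have hjM : j = M i := le_antisymm hj (not_lt.mp h)
      simp only [P', dif_neg h]
      rw [hjM]
      exact hPi i
  have hP'top : ∀ i, P' i (M i) = P i := fun i => by simp [P']
  -- (2) the base terms of the telescope
  let Ft : Fin k → ℕ → (Fin b → ℝ) → ℝ := fun i j x =>
    ((ε i : ℤ) : ℝ) * ((j : ℝ) + 1)⁻¹ * (d i x * (W i x - 1) ^ (j + 1))
  have hFt : ∀ i j, IsSemialgebraicFunOn ℚ G (Ft i j) := fun i j =>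
    (IsSemialgebraicFunOn.mul_holds (isSemialgebraicFunOn_ratCast hG ((ε i : ℚ) * ((j : ℚ) + 1)⁻¹))
      (IsSemialgebraicFunOn.mul_holds (hd i) (isSemialgebraicFunOn_pow' hG (hWs i) (j + 1)))).congr
      fun x _ => by simp only [Ft, Pi.mul_apply]; push_cast; ring
  have hFti : ∀ i j, j < M i → IntegrableOn (Ft i j) G := fun i j hj =>
    IntegrableOn.congr_fun ((hpow' i j hj).const_mul (((ε i : ℤ) : ℝ) * ((j : ℝ) + 1)⁻¹))
      (fun x _ => by simp only [Ft]) hGm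
  have hBt : ∀ i j, j < M i → ∃ Bb : KZ.IntegralRep b, Bb.domain = G ∧ Bb.integrand = Ft i j :=
    fun i j hj => exists_baseRep_of_integrableOn hG (hFt i j) (hFti i j hj)
  let Bt : Fin k → ℕ → KZ.IntegralRep b := fun i j => if h : j < M i then (hBt i j h).choose else B
  have hBtd : ∀ i j, j < M i → (Bt i j).domain = G := fun i j h => by
    simp only [Bt, dif_pos h]; exact (hBt i j h).choose_spec.1
  have hBti : ∀ i j, j < M i → (Bt i j).integrand = Ft i j := fun i j h => by
    simp only [Bt, dif_pos h]; exact (hBt i j h).choose_spec.2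
  -- (3) the ORDER TELESCOPE down to order 0, per index
  have hT : ∀ i, KZ.of (P' i 0) - ((-1:ℤ) ^ M i • KZ.of (P i) +
      ∑ j ∈ Finset.range (M i), (-1:ℤ) ^ j • KZ.of (Bt i j)) ∈ KZ.relations := by
    intro i
    cases hσ : σ i
    · -- reversed band `[W_i, 1]`
      have h := regOrder_telescope (M := 0) (m := M i) (Nat.zero_le _) (c := d i) (p := W i) (q := fun _ => 1)
        (hd i) (hW i) h1sa (fun x hx => (hσf i hσ x hx).1) (fun x hx => (hσf i hσ x hx).2) (P' i) (Bt i)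
        (fun j _ hj => by rw [hP'd i j hj]; simp [Dom, hσ]) (fun j _ hj => hP'i i j hj)
        (fun j _ hj => hBtd i j hj)
        (fun j _ hj x _ => by rw [hBti i j hj]; simp only [Ft, ε, hσ]; push_cast; simp; ring)
      simpa only [Nat.sub_zero, hP'top, Nat.Ico_zero_eq_range] using h
    · -- band `[1, W_i]`
      have h := regOrder_telescope (M := 0) (m := M i) (Nat.zero_le _) (c := d i) (p := fun _ => 1) (q := W i)
        (hd i) h1sa (hW i) (fun _ _ => one_pos) (hσt i hσ) (P' i) (Bt i)
        (fun j _ hj => by rw [hP'd i j hj]; simp [Dom, hσ]) (fun j _ hj => hP'i i j hj)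
        (fun j _ hj => hBtd i j hj)
        (fun j _ hj x _ => by rw [hBti i j hj]; simp only [Ft, ε, hσ]; push_cast; simp; ring)
      simpa only [Nat.sub_zero, hP'top, Nat.Ico_zero_eq_range] using h
  -- (4) the PURE-LOG cells `U_i = [band_i, (−1)^{M_i} d_i / t]` and the (R1) feed
  let h : Fin k → (Fin b → ℝ) → ℝ := fun i x => (-1) ^ M i * d i x
  have hh : ∀ i, IsSemialgebraicFunOn ℚ G (h i) := fun i =>
    (IsSemialgebraicFunOn.mul_holds (isSemialgebraicFunOn_ratCast hG ((-1) ^ M i)) (hd i)).congr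
      fun x _ => by simp only [h, Pi.mul_apply]; push_cast; ring
  have hhint : ∀ i, IntegrableOn (fun x => h i x * Real.log (W i x)) G := fun i =>
    IntegrableOn.congr_fun ((hlog i).const_mul ((-1:ℝ) ^ M i)) (fun x _ => by simp only [h]; ring) hGm
  have hU : ∀ i, ∃ R : KZ.IntegralRep (b + 1), R.domain = Dom i ∧
      EqOn R.integrand (fun z => h i (Fin.init z) / z (Fin.last b)) R.domain := by
    intro i
    cases hσ : σ i
    · obtain ⟨R, hRd, hRi⟩ := exists_regRep_of_integrableOn_log' (m := 0) hG (hh i) (hW i)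
        (fun x hx => (hσf i hσ x hx).1) (fun x hx => (hσf i hσ x hx).2) (hhint i)
      exact ⟨R, by simp [Dom, hσ, hRd], fun z _ => by rw [hRi]; simp [div_eq_mul_inv]⟩
    · obtain ⟨R, hRd, hRi⟩ := exists_logRep_of_integrableOn_log hG (hh i) (hW i) (hσt i hσ) (hhint i)
      exact ⟨R, by simp [Dom, hσ, hRd], fun z _ => by rw [hRi]⟩
  choose U hUd hUi using hU
  have hR1 : ∑ i, ε i • KZ.of (U i) ∈ KZ.relations :=
    r1_of_boundaryRigidity hBR hGo hG h W hh hW hWd σ hσt hσf hhint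
      (fun x hx => by simpa only [h] using hsum x hx) U (fun i => hUd i) hUi
  -- (5) rescaling the order-0 cells: `[U_i] − (−1)^{M_i} • [P'_i 0] ∈ rel`
  have hQ : ∀ i, KZ.of (U i) - (-1:ℤ) ^ M i • KZ.of (P' i 0) ∈ KZ.relations := by
    intro i
    refine of_zsmul_sub_mem_relations ((-1:ℤ) ^ M i) (P' i 0) (U i)
      (by rw [hUd i, hP'd i 0 (Nat.zero_le _)]) fun z hz => ?_
    show (U i).integrand z = (((-1:ℤ) ^ M i : ℤ) : ℝ) * (P' i 0).integrand z
    rw [hUi i (by rw [hUd i, ← hP'd i 0 (Nat.zero_le _)]; exact hz), hP'i i 0 (Nat.zero_le _) hz]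
    simp only [h]; push_cast; ring
  -- (6) the signed base terms consolidate to `[G, Σ d_i polyLog_{M_i}(W_i)]`
  have hBs : KZ.of B - ∑ p ∈ Finset.univ.sigma (fun i => Finset.range (M i)),
      (-(ε p.1 * (-1) ^ M p.1 * (-1) ^ p.2)) • KZ.of (Bt p.1 p.2) ∈ KZ.relations := by
    refine of_sub_sum_zsmul_mem_relations (Finset.univ.sigma fun i => Finset.range (M i))
      (fun p => Bt p.1 p.2) (fun p => -(ε p.1 * (-1) ^ M p.1 * (-1) ^ p.2)) B
      (fun p hp => by rw [hBd]; exact hBtd p.1 p.2 (Finset.mem_range.mp (Finset.mem_sigma.mp hp).2)) ?_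
    intro x hx
    have hxG : x ∈ G := hBd ▸ hx
    show B.integrand x = ∑ p ∈ Finset.univ.sigma (fun i => Finset.range (M i)),
      ((-(ε p.1 * (-1) ^ M p.1 * (-1) ^ p.2) : ℤ) : ℝ) * (Bt p.1 p.2).integrand x
    rw [hBi hxG, Finset.sum_sigma]
    refine Finset.sum_congr rfl fun i _ => ?_
    rw [polyLog, Finset.mul_sum]
    refine Finset.sum_congr rfl fun j hj => ?_
    have hjM : j < M i := Finset.mem_range.mp hj
    rw [hBti i j hjM, neg_one_pow_sub_sub hjM]
    have hε2 : ((ε i : ℤ) : ℝ) ^ 2 = 1 := by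
      simp only [ε]; cases σ i <;> simp
    simp only [Ft]
    push_cast
    linear_combination
      ((-1:ℝ) ^ M i * (-1) ^ j * ((j:ℝ) + 1)⁻¹ * d i x * (W i x - 1) ^ (j + 1)) * hε2
  have hBs' : KZ.of B + ∑ i, (ε i * (-1) ^ M i) • ∑ j ∈ Finset.range (M i), (-1:ℤ) ^ j • KZ.of (Bt i j) ∈
      KZ.relations := by
    convert hBs using 1
    rw [Finset.sum_sigma]
    simp only [Finset.smul_sum, smul_smul, neg_smul, Finset.sum_neg_distrib, sub_neg_eq_add]
  -- (7) assembly of the relations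
  have hE : ∀ i, ε i • KZ.of (P i) - ε i • KZ.of (U i) +
      (ε i * (-1) ^ M i) • ∑ j ∈ Finset.range (M i), (-1:ℤ) ^ j • KZ.of (Bt i j) ∈ KZ.relations := by
    intro i
    have hcc : ε i * (-1) ^ M i * (-1) ^ M i = ε i := by
      rw [mul_assoc, ← mul_pow]; simp
    have h12 := KZ.relations.add_mem (KZ.relations.zsmul_mem (hT i) (-(ε i * (-1) ^ M i)))
      (KZ.relations.zsmul_mem (hQ i) (-ε i))
    convert h12 using 1
    simp only [smul_sub, smul_add, smul_smul, neg_mul, hcc, neg_smul]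
    abel
  have hEs := sum_mem fun i (_ : i ∈ (Finset.univ : Finset (Fin k))) => hE i
  have key : ∑ i, ε i • KZ.of (P i) - KZ.of B =
      (∑ i, (ε i • KZ.of (P i) - ε i • KZ.of (U i) +
        (ε i * (-1) ^ M i) • ∑ j ∈ Finset.range (M i), (-1:ℤ) ^ j • KZ.of (Bt i j))) +
      ∑ i, ε i • KZ.of (U i) -
      (KZ.of B + ∑ i, (ε i * (-1) ^ M i) • ∑ j ∈ Finset.range (M i), (-1:ℤ) ^ j • KZ.of (Bt i j)) := by
    simp only [Finset.sum_add_distrib, Finset.sum_sub_distrib]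
    abel
  rw [key]
  exact KZ.relations.sub_mem (KZ.relations.add_mem hEs hR1) hBs'

/-! ### §3ag `CellCloseLS` ON THE TAME CLASS — `cellCloseLS_tame` PROVED from `BoundaryRigidity` BY NAME (g11)
The typed residual `CellCloseLS` (§3ad) restricted to TAME cells closes outright.  A cell `E` of exact integer
relations (the data of `CellCloseLS`) is TAME when, for every index with `κᵢ ≢ 0`, the regularised coefficient
`dᵢ = cᵢ/κᵢ^{Mᵢ+1}` satisfies `dᵢ log(1+κᵢ) ∈ L¹(E)` and, for `κᵢ > 0`, `dᵢ κᵢ^{j+1} ∈ L¹(E)` (`j < Mᵢ`).  These bounds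
are AUTOMATIC (from the cylinder integrability `hint`) at every end of `E` except a `κᵢ → 0` end of an index with
`Mᵢ ≥ 1` and `cᵢ/κᵢ^{Mᵢ} ∉ L¹` there — the DEGENERATE ends of NODE-g10 Addendum L, which are all that is left of
`CellCloseLS`.  Proof: D1 split (`KZ.of_sub_of_sub_sum_mem_relations`) · open→closed band · D4± / monomial fold /
θ-constant fold per index · the log identity from the exact relations (`hcoef`, `hprod`) · the polynomial
cancellation `hpoly` · `tameClose`. -/

/-- Semialgebraicity of a cylinder monomial `c(x)·θ^M/(1+θκ(x))` on a semialgebraic set over `G` off the pole. -/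
theorem sa_cylTerm {b : ℕ} (M : ℕ) {G : Set (Fin b → ℝ)} {B : Set (Fin (b + 1) → ℝ)}
    (hB : IsSemialgebraic ℚ B) (hBG : B ⊆ {z | (Fin.init z : Fin b → ℝ) ∈ G}) {c κ : (Fin b → ℝ) → ℝ}
    (hc : IsSemialgebraicFunOn ℚ G c) (hκ : IsSemialgebraicFunOn ℚ G κ)
    (hden : ∀ z ∈ B, 1 + z (Fin.last b) * κ (Fin.init z) ≠ 0) :
    IsSemialgebraicFunOn ℚ B
      (fun z => c (Fin.init z) * (z (Fin.last b) ^ M / (1 + z (Fin.last b) * κ (Fin.init z)))) := by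
  have hcI : IsSemialgebraicFunOn ℚ B (fun z => c (Fin.init z)) := hc.comp_init.mono hBG hB
  have hκI : IsSemialgebraicFunOn ℚ B (fun z => κ (Fin.init z)) := hκ.comp_init.mono hBG hB
  have hsI : IsSemialgebraicFunOn ℚ B (fun z => z (Fin.last b)) := Literature.NumberTheory.Transcendental.isSemialgebraicFunOn_apply hB (Fin.last b)
  have hdenI : IsSemialgebraicFunOn ℚ B (fun z => 1 + z (Fin.last b) * κ (Fin.init z)) :=
    (IsSemialgebraicFunOn.add_holds (isSemialgebraicFunOn_ratCast hB 1)
      (IsSemialgebraicFunOn.mul_holds hsI hκI)).congr fun _ _ => by simp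
  exact IsSemialgebraicFunOn.mul_holds hcI
    (IsSemialgebraicFunOn.div (isSemialgebraicFunOn_pow' hB hsI M) hdenI hden)

/-- No pole on the closed band: `0 < 1 + θκ` for `θ ∈ [0,1]`, `κ > −1`. -/
theorem one_add_mul_pos_of_gt_neg_one {θ κ : ℝ} (h0 : 0 ≤ θ) (h1 : θ ≤ 1) (hκ : -1 < κ) :
    0 < 1 + θ * κ := by
  rcases le_or_gt 0 κ with hk | hk
  · nlinarith [mul_nonneg h0 hk]
  · nlinarith [mul_nonneg (sub_nonneg.mpr h1) (neg_nonneg.mpr hk.le)]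

/-- A `θ`-constant integrand `a(x)` is integrable on the closed band `G × [0,1]` when `a ∈ L¹(G)`. -/
theorem integrableOn_comp_init_band {b : ℕ} {G : Set (Fin b → ℝ)} (hG : IsSemialgebraic ℚ G)
    {a : (Fin b → ℝ) → ℝ} (ha : IsSemialgebraicFunOn ℚ G a) (hai : IntegrableOn a G) :
    IntegrableOn (fun z : Fin (b + 1) → ℝ => a (Fin.init z)) (KZlog.band G (fun _ => 0) (fun _ => 1)) := by
  have h0sa : IsSemialgebraicFunOn ℚ G (fun _ => (0:ℝ)) :=
    (isSemialgebraicFunOn_ratCast hG 0).congr fun _ _ => by simp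
  have h1sa : IsSemialgebraicFunOn ℚ G (fun _ => (1:ℝ)) :=
    (isSemialgebraicFunOn_ratCast hG 1).congr fun _ _ => by simp
  have hband : IsSemialgebraic ℚ (KZlog.band G (fun _ => (0:ℝ)) (fun _ => 1)) :=
    KZlog.isSemialgebraic_band h0sa h1sa
  have hBm : MeasurableSet (KZlog.band G (fun _ => (0:ℝ)) (fun _ => 1)) := hband.measurableSet_holds
  have hsa : IsSemialgebraicFunOn ℚ (KZlog.band G (fun _ => (0:ℝ)) (fun _ => 1)) (fun z => a (Fin.init z)) :=
    ha.comp_init.mono (fun z hz => hz.1) hband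
  refine KZlog.integrableOn_band_of_lintegral_fibre_le hG.measurableSet_holds (a := fun _ => (0:ℝ))
    (b := fun _ => 1) hBm (fun x t => KZlog.snoc_mem_band)
    (KZ.aestronglyMeasurable_of_isSemialgebraicFunOn hsa hBm) (K := a) (fun x _ => ?_) hai
  simp only [Fin.init_snoc, lintegral_const, Measure.restrict_apply_univ, Real.volume_Icc, sub_zero,
    ENNReal.ofReal_one, mul_one, le_refl]

end CylLog
end RegularisedLogLayer
end Summit.KontsevichZagierPeriods.RootDecompRelativeModAbsolute.Rung30571
end
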